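import Literature.AlgebraicGeometry.Resolution.InseparableLocalUniformizationStepsThreeFourWeak
import Literature.AlgebraicGeometry.Resolution.InseparableLocalUniformizationSimplePoint
import Literature.AlgebraicGeometry.Resolution.InseparableLocalUniformizationEngineTower
import Literature.AlgebraicGeometry.Resolution.InseparableLocalUniformizationDefectStepTower
import Literature.AlgebraicGeometry.Resolution.Temkin2013CurveSmoothingProofs
import HarnessLib

/-!
# Inseparable local uniformization: Steps 3–4 of the proof of Thm. 4.1.1 discharged

Topic: `Literature/AlgebraicGeometry/Resolution`. M. Temkin, *Inseparable local uniformization*,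
J. Algebra 373 (2013) 65–119 = arXiv:0804.1554v3, proof of Thm. 4.1.1, Steps 3–4 (pp. 48–49;
p. 30 of the 41-pp. arXiv version held in the literature store), ending with (v3) "In
particular, `x₁` is `l`-smooth, and, replacing `l` with a purely inseparable extension, we can
also arrange that `x₁` is a simple `l`-smooth point."

The corrected rendering `Temkin2013_Steps34_tower` of these steps
(`InseparableLocalUniformizationEngineTower.lean`; the first rendering `Temkin2013_Steps34` is
mis-rendered, see there) is now a THEOREM: everything up to the last sentence is
`descentConclusionWeak_of_steps34Data` (`InseparableLocalUniformizationStepsThreeFourWeak.lean`: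
Lemma 2.8.4, openness of `Spec m°` in `Nr_m(S)`, Lemma 2.8.5 for normal schemes, descent of
`l`-smoothness along smooth covers over a field, E. Noether — all proved), and the last sentence
is `Temkin2013DescentConclusion.of_weak` (`InseparableLocalUniformizationSimplePoint.lean`:
separating transcendence bases after a purely inseparable extension of the constants, base
change and normalization, smooth over a field ⇒ regular — all proved). This file only composes
the two:

* `Temkin2013_Steps34_tower_holds : Temkin2013_Steps34_tower` — DISCHARGED.
* `Temkin2013Descent.of_abhyankar_smoothFibre` — hence Thm. 4.1.1 (`n = 1`, non-logarithmic
  descent form) depends on exactly two named facts of the paper: Thm. 5.5.2 (i)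
  (`Temkin2013Abhyankar`) and Thm. 3.3.1 for smooth generic fibres
  (`Temkin2013RelativeCurveSmoothFibre`, Berkovich-analytic), the curve-smoothing input being
  the theorem `Temkin2013CurveSmoothing_holds` and Steps 3–4 the theorem above
  (`Temkin2013Descent.of_frontier₃_tower`). Likewise `Temkin2013HeightLeOne.of_abhyankar_smoothFibre`.

## Source

* M. Temkin, *Inseparable local uniformization*, arXiv:0804.1554v3, proof of Thm. 4.1.1
  (pp. 47–50).
-/

noncomputable section

namespace Literature.AlgebraicGeometry.Resolution

universe u

/-- **Steps 3–4 of the proof of Temkin's Thm. 4.1.1, corrected rendering, DISCHARGED**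
(`descentConclusionWeak_of_steps34Data` followed by `Temkin2013DescentConclusion.of_weak`).
[cite: Temkin2013, proof of Thm. 4.1.1, Steps 3–4 (arXiv:0804.1554v3 pp. 48–49)] -/
theorem Temkin2013_Steps34_tower_holds : Temkin2013_Steps34_tower.{u} := by
  intro k K _ _ _ hfg O hk kb hkbfg hdim hDY B hBO hBfg hBfr A hAO hAfg hAfr hAn hBA K₁ _ _ hfin
    O₁ hO₁ m _ _ hmfin Om hOm hXS hOm' hSE
  exact Temkin2013DescentConclusion.of_weak O A K₁ O₁
    (descentConclusionWeak_of_steps34Data k K hfg O hk kb hkbfg hdim hDY B hBO hBfg hBfr A hAO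
      hAfg hAfr hAn hBA K₁ hfin O₁ hO₁ m hmfin Om hOm hXS hOm' hSE)

/-- **Thm. 4.1.1 (`n = 1`, non-logarithmic descent form) from two facts**
`{Temkin2013Abhyankar, Temkin2013RelativeCurveSmoothFibre}`: curve smoothing
(`Temkin2013CurveSmoothing_holds`) and Steps 3–4 (`Temkin2013_Steps34_tower_holds`) being
theorems. [cite: Temkin2013, Thm. 4.1.1, proof (arXiv:0804.1554v3 pp. 47–50)] -/
theorem Temkin2013Descent.of_abhyankar_smoothFibre (hA : Temkin2013Abhyankar.{u})
    (hsf : Temkin2013RelativeCurveSmoothFibre.{u}) : Temkin2013Descent.{u} :=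
  Temkin2013Descent.of_frontier₃_tower hA Temkin2013CurveSmoothing_holds hsf
    Temkin2013_Steps34_tower_holds

/-- **Thm. 1.3.2 in height `≤ 1` (corrected relative form) from the same two facts.**
[cite: Temkin2013, Thm. 1.3.2 in height at most one via Thm. 4.1.1] -/
theorem Temkin2013HeightLeOne.of_abhyankar_smoothFibre (hA : Temkin2013Abhyankar.{u})
    (hsf : Temkin2013RelativeCurveSmoothFibre.{u}) : Temkin2013HeightLeOne.{u} :=
  Temkin2013HeightLeOne.of_frontier₃_tower hA Temkin2013CurveSmoothing_holds hsf
    Temkin2013_Steps34_tower_holds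

end Literature.AlgebraicGeometry.Resolution
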